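import Summits.AtomisticToContinuum.Crystallization.Theorems.ExcessDecayLiouvilleLongRangePaths
import Summits.AtomisticToContinuum.Crystallization.Theorems.ExcessDecayLiouvilleHcpLiouvilleWeights

/-!
# `ExcessDecayLiouville.HcpLiouville` (stmt-AtomisticToContinuum-9332), line `Sketch` v4: the sup path bound

Sub-goal `blowdown_pathSup` (H0 of stub `stub_green`) of crux stmt-AtomisticToContinuum-9332
(`Summit.AtomisticToContinuum.Crystallization.Theses.ExcessDecayLiouville.HcpLiouville`), line `Sketch`,
skeleton v4.  For a finitely supported field `w` on the sites `S` of an admissible hcp-like datum and two sites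
`p, q`,

`‖w p − w q‖ ≤ 9 · (1 + dist p q) · √(nnForm t A w)`:

join the labels of `p` and `q` (site parametrisation `exists_siteParam`) by a chain of `n ≤ |Δi| + |Δj| + 2|Δk| + 2`
nearest-neighbour moves (`exists_path`, `move_dist_le`), bound each step by `√(nnForm)` (one bond is dominated by
the strain form, `flatDiff_nnForm_ge_pair`), and bound the coordinate differences by the distance
(`abs_coord_le_dist_siteParam`, the two sublattice origins being within `11/10`).  All `[folklore]`; a `--supports`
helper, nothing here closes an item.
-/

noncomputable section

namespace Summit.AtomisticToContinuum.Crystallization.Theorems.ExcessDecayLiouville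

open scoped BigOperators Topology Classical InnerProductSpace RealInnerProductSpace
open Literature.MathematicalPhysics.StatisticalMechanics
open Summit.AtomisticToContinuum.Crystallization.Theses.ExcessDecayLiouville
open Summit.AtomisticToContinuum.Crystallization.Theorems.PhononStabilityNegative

section

variable {t : Fin 2 → EuclideanSpace ℝ (Fin 3)} {A : EuclideanSpace ℝ (Fin 3) →L[ℝ] EuclideanSpace ℝ (Fin 3)}

/-- **Telescoping along a nearest-neighbour chain**: if consecutive sites `x s`, `x (s+1)` (`s < n`) are within
`11/10`, then `‖w (x 0) − w (x n)‖ ≤ n · √(nnForm t A w)` for finitely supported `w` (each bond is dominated by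
the strain form). [folklore] -/
theorem norm_sub_chain_le_mul_sqrt_nnForm (hA : Adm₀ A) (hI : Inner₀ t A)
    {w : EuclideanSpace ℝ (Fin 3) → EuclideanSpace ℝ (Fin 3)} (hw : (Function.support w).Finite)
    (x : ℕ → Sites₀ t A) :
    ∀ n : ℕ, (∀ s < n, dist ((x s : Sites₀ t A) : EuclideanSpace ℝ (Fin 3)) (x (s + 1)) ≤ 11 / 10) →
      ‖w (x 0) - w (x n)‖ ≤ n * Real.sqrt (nnForm t A w)
  | 0, _ => by simp
  | n + 1, h => by
    have ih := norm_sub_chain_le_mul_sqrt_nnForm hA hI hw x n (fun s hs => h s (by omega))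
    have hsq : ‖w (x n) - w (x (n + 1))‖ ^ 2 ≤ nnForm t A w :=
      flatDiff_nnForm_ge_pair hA hI w hw (x n).2 (x (n + 1)).2 (h n (by omega))
    have hstep : ‖w (x n) - w (x (n + 1))‖ ≤ Real.sqrt (nnForm t A w) := by
      have := Real.abs_le_sqrt hsq
      rwa [abs_norm] at this
    calc ‖w (x 0) - w (x (n + 1))‖ ≤ ‖w (x 0) - w (x n)‖ + ‖w (x n) - w (x (n + 1))‖ :=
          norm_sub_le_norm_sub_add_norm_sub _ _ _
      _ ≤ n * Real.sqrt (nnForm t A w) + Real.sqrt (nnForm t A w) := add_le_add ih hstep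
      _ = ((n + 1 : ℕ) : ℝ) * Real.sqrt (nnForm t A w) := by push_cast; ring

/-- The two sublattice origins are within `11/10`: `‖t m − t m'‖ ≤ 11/10`. [folklore] -/
theorem norm_t_sub_t_le_of_fin (hA : Adm₀ A) (hI : Inner₀ t A) (m m' : Fin 2) : ‖t m - t m'‖ ≤ 11 / 10 := by
  have h := norm_t_sub_t_le hA hI
  fin_cases m <;> fin_cases m'
  · norm_num
  · simpa [norm_sub_rev] using h
  · simpa using h
  · norm_num

end

/-- **Sup path bound** (sub-goal `blowdown_pathSup`, H0 of stub `stub_green`, crux stmt-AtomisticToContinuum-9332,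
line `Sketch` v4): for a finitely supported field `w` on the sites of an admissible hcp-like datum, differences of
point values are controlled by `(1 + distance) × energy norm`, with the universal constant `9`. [folklore] -/
theorem blowdown_pathSup : ∃ C : ℝ, ∀ (t : Fin 2 → (EuclideanSpace ℝ (Fin 3)))
    (A : (EuclideanSpace ℝ (Fin 3)) →L[ℝ] (EuclideanSpace ℝ (Fin 3))), Adm₀ A → Inner₀ t A →
    ∀ w : (EuclideanSpace ℝ (Fin 3)) → (EuclideanSpace ℝ (Fin 3)), (Function.support w).Finite →
    Function.support w ⊆ Sites₀ t A → ∀ p ∈ Sites₀ t A, ∀ q ∈ Sites₀ t A,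
      ‖w p - w q‖ ≤ C * (1 + dist p q) * Real.sqrt (nnForm t A w) := by
  refine ⟨9, fun t A hA hI w hw _ p hp q hq => ?_⟩
  obtain ⟨e, he⟩ := exists_siteParam hA hI
  obtain ⟨⟨m, i, j, k⟩, hℓp⟩ : ∃ ℓ : Fin 2 × ℤ × ℤ × ℤ, e ℓ = ⟨p, hp⟩ := ⟨e.symm ⟨p, hp⟩, e.apply_symm_apply _⟩
  obtain ⟨⟨m', i', j', k'⟩, hℓq⟩ : ∃ ℓ : Fin 2 × ℤ × ℤ × ℤ, e ℓ = ⟨q, hq⟩ :=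
    ⟨e.symm ⟨q, hq⟩, e.apply_symm_apply _⟩
  obtain ⟨n, hn, γ, hγ0, hγn, hγ⟩ := exists_path m m' (i' - i) (j' - j) (k' - k)
  -- the chain of sites from `p` to `q`
  set b : ℤ × ℤ × ℤ := (i, j, k) with hb
  set x : ℕ → Sites₀ t A := fun s => e ((γ s).1, b + (γ s).2) with hx
  have hx0 : x 0 = ⟨p, hp⟩ := by
    rw [← hℓp]
    simp only [hx, hγ0, hb, Prod.mk_add_mk, add_zero]
  have hbq : b + (i' - i, j' - j, k' - k) = (i', j', k') := by
    ext <;> simp [hb]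
  have hxn : x n = ⟨q, hq⟩ := by
    rw [← hℓq]
    simp only [hx, hγn, hbq]
  have hchain : ∀ s < n, dist ((x s : Sites₀ t A) : EuclideanSpace ℝ (Fin 3)) (x (s + 1)) ≤ 11 / 10 :=
    fun s hs => move_dist_le hA hI e he b (hγ s hs)
  have hmain := norm_sub_chain_le_mul_sqrt_nnForm hA hI hw x n hchain
  rw [hx0, hxn] at hmain
  -- `n ≤ 9 (1 + dist p q)`
  have hpe : p = t m + A ((i : ℝ) • triangularVec₁ 1 + (j : ℝ) • triangularVec₂ 1 +
      (k : ℝ) • layerNormal (2 * Real.sqrt (2 / 3))) := by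
    have := he m i j k
    rwa [hℓp] at this
  have hqe : q = t m' + A ((i' : ℝ) • triangularVec₁ 1 + (j' : ℝ) • triangularVec₂ 1 +
      (k' : ℝ) • layerNormal (2 * Real.sqrt (2 / 3))) := by
    have := he m' i' j' k'
    rwa [hℓq] at this
  have hz : ((((i' - i : ℤ)) : ℝ) • triangularVec₁ 1 + (((j' - j : ℤ)) : ℝ) • triangularVec₂ 1 +
      (((k' - k : ℤ)) : ℝ) • layerNormal (2 * Real.sqrt (2 / 3)) : EuclideanSpace ℝ (Fin 3)) =
      ((i' : ℝ) • triangularVec₁ 1 + (j' : ℝ) • triangularVec₂ 1 + (k' : ℝ) • layerNormal (2 * Real.sqrt (2 / 3))) -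
      ((i : ℝ) • triangularVec₁ 1 + (j : ℝ) • triangularVec₂ 1 + (k : ℝ) • layerNormal (2 * Real.sqrt (2 / 3))) := by
    push_cast
    module
  have hAz : A ((i' : ℝ) • triangularVec₁ 1 + (j' : ℝ) • triangularVec₂ 1 + (k' : ℝ) • layerNormal (2 * Real.sqrt (2 / 3))) -
      A ((i : ℝ) • triangularVec₁ 1 + (j : ℝ) • triangularVec₂ 1 + (k : ℝ) • layerNormal (2 * Real.sqrt (2 / 3))) =
      (q - p) - (t m' - t m) := by
    rw [hpe, hqe]
    abel
  have hdist : dist ((e (m', i' - i, j' - j, k' - k) : Sites₀ t A) : EuclideanSpace ℝ (Fin 3)) (e (m', 0, 0, 0)) =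
      ‖(q - p) - (t m' - t m)‖ := by
    rw [he, he, hz, map_sub, dist_eq_norm, hAz]
    simp only [Int.cast_zero, zero_smul, add_zero, map_zero]
    congr 1
    abel
  have hD : dist ((e (m', i' - i, j' - j, k' - k) : Sites₀ t A) : EuclideanSpace ℝ (Fin 3)) (e (m', 0, 0, 0)) ≤
      dist p q + 11 / 10 := by
    rw [hdist, dist_eq_norm, ← norm_sub_rev q p]
    exact (norm_sub_le _ _).trans (add_le_add le_rfl (norm_t_sub_t_le_of_fin hA hI m' m))
  obtain ⟨hi, hj, hk⟩ := abs_coord_le_dist_siteParam hA e he m' (i' - i) (j' - j) (k' - k)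
  have hcast : ∀ a : ℤ, ((a.natAbs : ℕ) : ℝ) = |(a : ℝ)| := fun a => by
    rw [Nat.cast_natAbs, Int.cast_abs]
  have hn' : (n : ℝ) ≤ |((i' - i : ℤ) : ℝ)| + |((j' - j : ℤ) : ℝ)| + 2 * |((k' - k : ℤ) : ℝ)| + 2 := by
    rw [← hcast, ← hcast, ← hcast]
    exact_mod_cast hn
  have hd0 : 0 ≤ dist p q := dist_nonneg
  have hn9 : (n : ℝ) ≤ 9 * (1 + dist p q) := by linarith
  exact hmain.trans (mul_le_mul_of_nonneg_right hn9 (Real.sqrt_nonneg _))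

end Summit.AtomisticToContinuum.Crystallization.Theorems.ExcessDecayLiouville

end
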